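import Literature.Computability.QuantumComplexity.ApproxStabilizerRankTransfer
import Literature.Computability.QuantumComplexity.StabilizerSimulationGadgetProofs
import Literature.Computability.QuantumComplexity.StabilizerSimulationMagicT
import Literature.Computability.Cryptography.QuantumCircuitProofs
import Literature.Computability.Cryptography.QubitRegisterHGateProofs
import Literature.Computability.Cryptography.QubitRegisterCnotProofs
import HarnessLib

/-!
# Approximate stabilizer rank under `T`-gadgets and ancilla removal — discharges of Mehraban–Tahmasbi 2024, Lemma 3.6 and §3.4 (a)

Topic `Literature/Computability/QuantumComplexity`. This file discharges the named facts
`MehrabanTahmasbi2024_approxRank_output_le` and `MehrabanTahmasbi2024_approxRank_le_tensor_zeroState`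
of `ApproxStabilizerRankTransfer.lean` (kept in a sibling file so that the statement file keeps its
light import cone):

* `MehrabanTahmasbi2024_approxRank_output_le_holds` — for an oracle-free Clifford+`T` circuit `U`
  on `N` wires with `k` `T`-gates and every `δ`, `χ_δ(U|0^N⟩) ≤ χ_δ(|T⟩^{⊗k})`
  (S. Mehraban, M. Tahmasbi, *Quadratic lower bounds on the approximate stabilizer rank: a
  probabilistic approach*, STOC 2024 = arXiv:2305.10277, Lemma 3.6, proved in §3.3 from
  Lemma 3.7 (uniform gadget outcomes) and Lemma 3.8 (a balanced measurement does not increase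
  `χ_δ` for at least one outcome)).
* `MehrabanTahmasbi2024_approxRank_le_tensor_zeroState_holds` — `χ_δ(ψ) ≤ χ_δ(ψ ⊗ |0^m⟩)` for
  every `n`-qubit vector `ψ`, every `m` and every real `δ` (loc. cit., §3.4, step (a) of the
  display concluding the proof of Theorem 3.1, arXiv v. p. 14: removing clean ancillas does not
  lower the approximate stabilizer rank).

## The printed proof (arXiv v. pp. 13–14) and how it is mirrored

"We replace each `T` gate in the circuit with the gadget introduced in [Gottesman–Chuang 1999] …
`V|0ⁿ⟩ = 2^{k/2} C_k^{x_k} (1 ⊗ ⟨x_k|) ⋯ C_1^{x_1} (1 ⊗ ⟨x_1|) C_0 |0ⁿ⟩ ⊗ |T⟩^{⊗k}` where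
`C_i^b` is a Clifford circuit … In the beginning, `χ_δ(|0ⁿ⟩ ⊗ |T^{⊗k}⟩) = χ_δ(|T^{⊗k}⟩)`. By
Lemma 3.8, at each measurement, the approximate stabilizer rank does not increase for one output.
As approximate stabilizer rank is invariant under Clifford operations, we conclude …".

Over the tree's definitions (`approxStabilizerRank`, `stabilizerRank`, `stabilizerStates`,
`QCircuit cliffordT`, `tCount`) the argument is organised as an induction on the gate list, one
gate at a time, for an arbitrary input vector `ψ` (the printed proof gadgetizes all `T` gates at
once; gate-by-gate is the same bookkeeping):

* **Clifford invariance** `approxRank_mulVec_le_of_mem_cliffordCircuits`: `χ_δ(CΦ) ≤ χ_δ(Φ)` for a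
  Clifford circuit `C` — Clifford circuits are unitary (`cliffordCircuits_le_unitaryGroup`, from the
  tree's `hGate/sGate/cnot_mem_unitaryGroup_holds`), so `‖CΦ - CΘ‖ = ‖Φ - Θ‖`, and they map
  stabilizer states to stabilizer states.
* **The gadget step** `approxRank_tGate_mulVec_le`: `χ_δ(T_q Φ) ≤ χ_δ(Φ ⊗ |T⟩)`. With
  `Ψ = CNOT_{q→a}(Φ ⊗ |T⟩_a)` one has the two exact reconstructions
  `T_q Φ = √2 (1 ⊗ ⟨0|_a) Ψ` (tree: `projZ_cnot_mulVec_tensorVec_magicT`, Bravyi et al. 2019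
  eq. (15)) and `T_q Φ = √2 ω⁻¹ S_q (1 ⊗ ⟨1|_a) Ψ` (`sGate_mulVec_projZ_xWord_cnot_tensorVec_magicT`;
  the Clifford correction `S` for outcome `1`, `ω = e^{iπ/4}`; `⟨1|_a` is written `⟨0|_a X_a` with the
  tree's Clifford word `X = H S S H`, so that only the tree's `projZ` is needed). The common factor
  `√2` is the uniformity of the outcomes, Lemma 3.7. Given `Θ` with `‖Φ ⊗ |T⟩ - Θ‖ ≤ δ` of rank
  `χ_δ`, `‖Ψ - CNOT Θ‖² = ‖(1⊗⟨0|)(Ψ - CNOT Θ)‖² + ‖(1⊗⟨1|)(Ψ - CNOT Θ)‖²`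
  (`normSq_eq_projZ_add_projZ_xWord`), so one outcome `b` carries at most half the squared error —
  this is Lemma 3.8, isolated as `approxRank_le_of_balanced_reconstructions` — and the corresponding
  reconstruction applied to `CNOT Θ` is a `δ`-approximation of `T_q Φ` by a combination of as many
  stabilizer states (`(1 ⊗ ⟨b|)` maps stabilizer states to scaled stabilizer states: the tree's
  Gottesman–Knill removal lemma `exists_smul_stabilizer_projZ`).
* **Ancilla block** `approxRank_tensorVec_zeroState_left_le`: `χ_δ(|0^N⟩ ⊗ φ) ≤ χ_δ(φ)` ("in the
  beginning …"), and the assembly `approxRank_toMatrix_mulVec_le` /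
  `MehrabanTahmasbi2024_approxRank_output_le_holds`.

No normalisation of post-measurement states is needed: the tree's `χ_δ` is defined for arbitrary
vectors and the reconstructions above are exact vector identities.

**§3.4 (a).** The source: "(a) follows since `I ⊗ |0^λ⟩⟨0^λ|` maps stabilizer states to scalar
multiples of stabilizer states or `0`, and therefore, any approximate decomposition of `φ ⊗ |0^λ⟩`
into stabilizer states yields a decomposition of `φ` with the same number of terms and approximation
parameter by first applying `I ⊗ |0^λ⟩⟨0^λ|` to each stabilizer term and then tensoring out the
last `λ` qubits." Verbatim over the tree's definitions: the restriction `projZ m : Φ ↦ (x ↦ Φ(x, 0^m))`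
(the map `1 ⊗ ⟨0^m|` of `StabilizerSimulationGadgetProofs.lean`) sends `ψ ⊗ |0^m⟩` to `ψ` and keeps a
sub-family of the coordinates, so `‖ψ - projZ m Φ‖² ≤ ‖ψ ⊗ |0^m⟩ - Φ‖²` (`normSq_sub_projZ_le`, "the
same approximation parameter"); it maps stabilizer states to scaled stabilizer states or `0` (the
tree's Gottesman–Knill postselection rule `exists_smul_stabilizer_projZ`), hence does not increase `χ`
(`stabilizerRank_projZ_le`, "the same number of terms"); applied to an optimal `δ`-approximant of
`ψ ⊗ |0^m⟩` this gives `χ_δ(ψ) ≤ χ_δ(ψ ⊗ |0^m⟩)` (`approxRank_le_approxRank_tensorVec_zeroState`).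

## Tree reuse

`StabilizerSimulationGadgetProofs.lean` (namespace `StabilizerFormalism`: `projZ`, `projZ_cnot_mulVec_tensorVec_magicT`,
`exists_smul_stabilizer_projZ`, `placeGate_cnot_mem`, `castAdd_one_ne_natAdd`, `update_append_natAdd`,
`tensorVec_append`, `tensorVec_tensorVec_one`, `wireEmb_trans_castAddEmb`, `toMatrix_gate_mem_cliffordCircuits`,
`placeGate_tGate_mulVec_apply`, `projZ_zero`, `projZ_zero_tensorVec_tensorPow_zero`, `invSqrt2_ne_zero`),
`StabilizerSimulationProofs.lean` (`exists_stabilizerDecomposition`, `stabilizerRank_le_card`,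
`placeGate_castAddEmb_mulVec_tensorVec`, `placeGate_mem_cliffordCircuits`, `tensorVec_mem_stabilizerStates`,
`xWord_toMatrix_mem_cliffordCircuits`), `StabilizerSimulationMagicT.lean` (`normSq_tensorVec`,
`norm_omega_eq_one`), `StabilizerSimulationSparsification.lean` (`normSq_const_smul`), `QuantumCircuitProofs.lean` (`normSq_mulVec_of_mem_unitaryGroup`),
`QubitRegister*Proofs.lean` (unitarity of `H`, `S`, `CNOT`, `placements_subset_unitaryGroup_holds`),
`ReversibleCliffordT.lean` (`xWord_mulVec_basisState`, `cnotOn_mulVec_basisState`, `omega_pow_two`),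
`LightConeAmp.lean` (`mulVec_apply_of_perm`, `placeGate_wireEmb_mulVec_apply`), `BQPProofs.lean`
(`norm_invSqrt2_pow_sq`), `CliffordSimulator.lean` (`CliffordSim.magicT_apply`).

## References

* S. Mehraban, M. Tahmasbi, *Quadratic lower bounds on the approximate stabilizer rank: a
  probabilistic approach*, Proc. 56th STOC (2024) = arXiv:2305.10277: Lemma 3.6 (p. 13), Lemma 3.7
  and Lemma 3.8 with proofs, proof of Lemma 3.6 (pp. 13–14); §3.4, step (a) of the display concluding
  the proof of Theorem 3.1 and the sentence after it (p. 14) (read via `lit read arxiv:2305.10277`).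
* S. Aaronson, D. Gottesman, *Improved simulation of stabilizer circuits*, Phys. Rev. A 70 (2004)
  052328, §III (standard-basis measurement/postselection of stabilizer states — the rule behind
  `exists_smul_stabilizer_projZ`, formalized in `StabilizerSimulationGadgetProofs.lean`).
* D. Gottesman, I. L. Chuang, *Demonstrating the viability of universal quantum computation using
  teleportation and single-qubit operations*, Nature 402 (1999) 390–393 (the `T` gadget).
* S. Bravyi, D. Browne, P. Calpin, E. Campbell, D. Gosset, M. Howard, *Simulation of quantum
  circuits by low-rank stabilizer decompositions*, Quantum 3 (2019) 181, §2.3.1 eq. (15).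
-/

noncomputable section

namespace Literature.Computability.QuantumComplexity

open _root_.Computability Cryptography Matrix StabilizerFormalism

namespace ApproxRankTransfer

/-! ### Generic facts: the infima defining `χ_δ` and `χ` -/

section generic

variable {n m : ℕ}

/-- **`χ_δ` is attained**: some `Θ` with `‖ψ - Θ‖ ≤ δ` has `χ(Θ) = χ_δ(ψ)` (the admissible set of
ranks is nonempty, `Θ = ψ` being admissible). [Bravyi et al. 2019, §2] [folklore] -/
theorem exists_approximant (δ : ℝ) (ψ : QReg n → ℂ) :
    ∃ θ : QReg n → ℂ, normSq (ψ - θ) ≤ δ ^ 2 ∧ stabilizerRank θ = approxStabilizerRank δ ψ := by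
  have hne : {r | ∃ φ : QReg n → ℂ, normSq (ψ - φ) ≤ δ ^ 2 ∧ stabilizerRank φ = r}.Nonempty :=
    ⟨stabilizerRank ψ, ψ, by simp [Cryptography.normSq, sq_nonneg], rfl⟩
  exact Nat.sInf_mem hne

/-- A `δ`-close vector witnesses `χ_δ(ψ) ≤ χ(Θ)`. [Bravyi et al. 2019, §2] [folklore] -/
theorem approxStabilizerRank_le_of_witness (δ : ℝ) (ψ θ : QReg n → ℂ) (h : normSq (ψ - θ) ≤ δ ^ 2) :
    approxStabilizerRank δ ψ ≤ stabilizerRank θ :=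
  Nat.sInf_le ⟨θ, h, rfl⟩

/-- **Linear maps sending stabilizer states to scaled stabilizer states (or `0`) do not increase
the stabilizer rank** (apply the map term by term to an optimal decomposition).
[Mehraban–Tahmasbi 2024, proof of Lemma 3.8 (last display) and §3.4 (a)] [folklore] -/
theorem stabilizerRank_map_le (L : (QReg n → ℂ) → (QReg m → ℂ))
    (hadd : ∀ a b, L (a + b) = L a + L b) (hsmul : ∀ (c : ℂ) (a), L (c • a) = c • L a)
    (hS : ∀ φ ∈ stabilizerStates n, ∃ (d : ℂ) (φ' : QReg m → ℂ), φ' ∈ stabilizerStates m ∧ L φ = d • φ')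
    (θ : QReg n → ℂ) : stabilizerRank (L θ) ≤ stabilizerRank θ := by
  obtain ⟨c, φ, hφ, hdec⟩ := exists_stabilizerDecomposition θ
  choose d φ' hφ' hd using fun i => hS (φ i) (hφ i)
  have lin : IsLinearMap ℂ L := ⟨hadd, hsmul⟩
  refine (stabilizerRank_le_card (fun i => c i * d i) φ' hφ' ?_).trans (by simp)
  calc L θ = lin.mk' L (∑ i, c i • φ i) := by rw [← hdec]; rfl
    _ = ∑ i, lin.mk' L (c i • φ i) := map_sum _ _ _
    _ = ∑ i, (c i * d i) • φ' i := Finset.sum_congr rfl fun i _ => by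
        rw [IsLinearMap.mk'_apply, hsmul, hd, smul_smul]

end generic

/-! ### Norm bookkeeping -/

section norms

variable {n : ℕ}

/-- The Clifford gate set `{H, S, CNOT}` is unitary. [Nielsen–Chuang 2010, §4.2–4.3] [folklore] -/
theorem clifford_isUnitary : clifford.IsUnitary := by
  rintro (_ | _ | _)
  · exact hGate_mem_unitaryGroup_holds
  · exact sGate_mem_unitaryGroup_holds
  · exact cnot_mem_unitaryGroup_holds

/-- **Clifford circuits are unitary** (products of placements of unitary gates).
[Nielsen–Chuang 2010, §4.2] [folklore] -/
theorem cliffordCircuits_le_unitaryGroup (n : ℕ) :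
    cliffordCircuits n ≤ Matrix.unitaryGroup (QReg n) ℂ :=
  Submonoid.closure_le.2 (QGateSet.placements_subset_unitaryGroup_holds clifford_isUnitary n)

/-- Clifford circuits preserve the norm. [Nielsen–Chuang 2010, §2.1.6] [folklore] -/
theorem normSq_mulVec_of_mem_cliffordCircuits {C : Matrix (QReg n) (QReg n) ℂ}
    (hC : C ∈ cliffordCircuits n) (v : QReg n → ℂ) : normSq (C *ᵥ v) = normSq v :=
  normSq_mulVec_of_mem_unitaryGroup (cliffordCircuits_le_unitaryGroup n hC) v

/-- `‖(1/√2)⁻¹‖² = 2`. [folklore] -/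
theorem norm_invSqrt2_inv_sq : ‖(invSqrt2 : ℂ)⁻¹‖ ^ 2 = 2 := by
  have h : ‖(invSqrt2 : ℂ)‖ ^ 2 = 1 / 2 := by
    have h' := norm_invSqrt2_pow_sq 1
    rwa [pow_one, pow_one] at h'
  rw [norm_inv, inv_pow, h]
  norm_num

/-- `‖(ω/√2)⁻¹‖² = 2`. [folklore] -/
theorem norm_invSqrt2_mul_omega_inv_sq : ‖((invSqrt2 : ℂ) * omega)⁻¹‖ ^ 2 = 2 := by
  rw [mul_inv, norm_mul, mul_pow, norm_inv omega, norm_omega_eq_one, inv_one, one_pow, mul_one]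
  exact norm_invSqrt2_inv_sq

/-- `ψ ⊗ ·` is additive. [folklore] -/
theorem tensorVec_add_right {a b : ℕ} (ψ : QReg a → ℂ) (φ φ' : QReg b → ℂ) :
    tensorVec ψ (φ + φ') = tensorVec ψ φ + tensorVec ψ φ' := by
  funext z; simp only [tensorVec_apply, Pi.add_apply, mul_add]

/-- `ψ ⊗ ·` is homogeneous. [folklore] -/
theorem tensorVec_smul_right {a b : ℕ} (ψ : QReg a → ℂ) (c : ℂ) (φ : QReg b → ℂ) :
    tensorVec ψ (c • φ) = c • tensorVec ψ φ := by
  funext z; simp only [tensorVec_apply, Pi.smul_apply, smul_eq_mul, mul_left_comm]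

/-- `ψ ⊗ ·` respects differences. [folklore] -/
theorem tensorVec_sub_right {a b : ℕ} (ψ : QReg a → ℂ) (φ φ' : QReg b → ℂ) :
    tensorVec ψ (φ - φ') = tensorVec ψ φ - tensorVec ψ φ' := by
  funext z; simp only [tensorVec_apply, Pi.sub_apply, mul_sub]

end norms

/-! ### The outcome-`1` branch of the gadget -/

section gadget

variable {M : ℕ}

/-- The `S` gate on a wire, in the Schrödinger picture: `(S_q Ψ)(x) = i^{x_q} Ψ(x)`.
[Nielsen–Chuang 2010, §4.2] [folklore] -/
theorem placeGate_sGate_mulVec_apply (q : Fin M) (Ψ : QReg M → ℂ) (x : QReg M) :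
    (placeGate (wireEmb q) sGate *ᵥ Ψ) x = (if x q then Complex.I else 1) * Ψ x := by
  rw [LightCone.placeGate_wireEmb_mulVec_apply]
  cases hx : x q
  · have h1 : Function.update x q false = x := by rw [← hx, Function.update_eq_self]
    simp [sGate, funext_iff, h1]
  · have h1 : Function.update x q true = x := by rw [← hx, Function.update_eq_self]
    simp [sGate, funext_iff, h1]

/-- **`⟨1| = ⟨0| X` on the last wire**, pointwise: `((1 ⊗ ⟨0|) X_a Φ)(x) = Φ(x, 1)`, with
`X = H S S H` the tree's Clifford word `xWord` (so that `(1 ⊗ ⟨1|)` is expressed through the tree's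
`projZ 1` and a Clifford circuit). [Nielsen–Chuang 2010, §4.2 Ex. 4.18] [folklore] -/
theorem projZ_xWord_mulVec_apply (Φ : QReg (M + 1) → ℂ) (x : QReg M) :
    projZ 1 ((⟨xWord (Fin.natAdd M (0 : Fin 1))⟩ : QCircuit cliffordT (M + 1)).toMatrix 0 *ᵥ Φ) x =
      Φ (Fin.append x fun _ => true) := by
  have hπ : Function.Involutive fun w : QReg (M + 1) =>
      Function.update w (Fin.natAdd M 0) (!w (Fin.natAdd M 0)) := by
    intro w
    dsimp only
    funext l
    by_cases hl : l = Fin.natAdd M 0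
    · subst hl
      simp
    · simp [Function.update_of_ne hl]
  rw [projZ_apply, LightCone.mulVec_apply_of_perm hπ (fun w => xWord_mulVec_basisState 0 _ w),
    Fin.append_right, update_append_natAdd]
  have h0 : Function.update (fun _ : Fin 1 => false) 0 (!false) = fun _ => true :=
    funext fun j => by rw [Subsingleton.elim j 0, Function.update_self, Bool.not_false]
  rw [h0]

/-- **Pythagoras along the last wire**: `‖Φ‖² = ‖(1⊗⟨0|)Φ‖² + ‖(1⊗⟨1|)Φ‖²` ("since `|0⟩` and `|1⟩`
are orthogonal", proof of Lemma 3.8), the second block written as `(1 ⊗ ⟨0|) X_a Φ`.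
[Mehraban–Tahmasbi 2024, proof of Lemma 3.8] [folklore] -/
theorem normSq_eq_projZ_add_projZ_xWord (Φ : QReg (M + 1) → ℂ) :
    normSq Φ = normSq (projZ 1 Φ) +
      normSq (projZ 1 ((⟨xWord (Fin.natAdd M (0 : Fin 1))⟩ : QCircuit cliffordT (M + 1)).toMatrix 0 *ᵥ Φ)) := by
  unfold Cryptography.normSq
  rw [← (Fin.appendEquiv M 1).sum_comp _, Fintype.sum_prod_type, ← Finset.sum_add_distrib]
  refine Finset.sum_congr rfl fun x _ => ?_
  rw [sum_qReg_one, Fintype.sum_bool, add_comm, projZ_xWord_mulVec_apply]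
  rfl

/-- **The gadget with outcome `1` and its Clifford correction**: for any `M`-qubit vector `Ψ`
and wire `q`, `S_q (1 ⊗ ⟨1|_a) CNOT_{q → a} (Ψ ⊗ |T⟩_a) = (ω/√2) T_q Ψ` (`ω = e^{iπ/4}`,
`⟨1|_a = ⟨0|_a X_a`; together with the outcome-`0` identity
`(1 ⊗ ⟨0|_a) CNOT_{q→a} (Ψ ⊗ |T⟩_a) = T_q Ψ/√2` of the tree this is the Gottesman–Chuang `T`
gadget, both outcomes having weight `1/2` — Lemma 3.7).
[Mehraban–Tahmasbi 2024, Lemma 3.7 and Fig. 1; Gottesman–Chuang 1999] [folklore] -/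
theorem sGate_mulVec_projZ_xWord_cnot_tensorVec_magicT (q : Fin M) (Ψ : QReg M → ℂ) :
    placeGate (wireEmb q) sGate *ᵥ
        projZ 1 ((⟨xWord (Fin.natAdd M (0 : Fin 1))⟩ : QCircuit cliffordT (M + 1)).toMatrix 0 *ᵥ
          (placeGate (pairEmb (Fin.castAdd 1 q) (Fin.natAdd M 0) (castAdd_one_ne_natAdd q)) cnot *ᵥ
            tensorVec Ψ magicT)) =
      (invSqrt2 * omega) • (placeGate (wireEmb q) tGate *ᵥ Ψ) := by
  have hπ : Function.Involutive fun w : QReg (M + 1) =>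
      Function.update w (Fin.natAdd M 0) (w (Fin.natAdd M 0) ^^ w (Fin.castAdd 1 q)) := by
    intro w
    dsimp only
    funext l
    by_cases hl : l = Fin.natAdd M 0
    · subst hl
      simp [Function.update_of_ne (castAdd_one_ne_natAdd q)]
    · simp [Function.update_of_ne hl]
  funext x
  rw [placeGate_sGate_mulVec_apply, projZ_xWord_mulVec_apply, ← cnotOn_toMatrix 0,
    LightCone.mulVec_apply_of_perm hπ (fun w => cnotOn_mulVec_basisState 0 _ _ (castAdd_one_ne_natAdd q) w),
    Fin.append_right, Fin.append_left, Bool.true_xor, update_append_natAdd, tensorVec_append, Pi.smul_apply,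
    smul_eq_mul, placeGate_tGate_mulVec_apply, CliffordSim.magicT_apply]
  have h0 : Function.update (fun _ : Fin 1 => true) 0 (!x q) = fun _ => !x q :=
    funext fun j => by rw [Subsingleton.elim j 0, Function.update_self]
  rw [h0]
  cases x q
  · simp
    ring
  · simp
    rw [← omega_pow_two]
    ring

end gadget

/-! ### The three monotonicity steps -/

section steps

variable {n M N : ℕ}

/-- **"Approximate stabilizer rank is invariant under Clifford operations"** (the inequality
`χ_δ(CΦ) ≤ χ_δ(Φ)`; unitarity of `C` transports the error, and `C` maps stabilizer
decompositions to stabilizer decompositions). [Mehraban–Tahmasbi 2024, proof of Lemma 3.6] [folklore] -/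
theorem approxRank_mulVec_le_of_mem_cliffordCircuits {C : Matrix (QReg n) (QReg n) ℂ}
    (hC : C ∈ cliffordCircuits n) (δ : ℝ) (Φ : QReg n → ℂ) :
    approxStabilizerRank δ (C *ᵥ Φ) ≤ approxStabilizerRank δ Φ := by
  obtain ⟨θ, hθ, hr⟩ := exists_approximant δ Φ
  rw [← hr]
  refine (approxStabilizerRank_le_of_witness δ _ (C *ᵥ θ) ?_).trans ?_
  · rw [← Matrix.mulVec_sub, normSq_mulVec_of_mem_cliffordCircuits hC]
    exact hθ
  · exact stabilizerRank_map_le (fun v => C *ᵥ v) (fun a b => Matrix.mulVec_add _ _ _)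
      (fun c a => Matrix.mulVec_smul _ _ _)
      (fun φ hφ => ⟨1, C *ᵥ φ, mulVec_mem_stabilizerStates hC hφ, (one_smul _ _).symm⟩) θ

/-- **Lemma 3.8 in abstract form (a balanced pair of reconstructions)**: if `τ = L₀ σ = L₁ σ`
for two linear maps `L₀, L₁` which send stabilizer states to scaled stabilizer states and satisfy
`‖L₀ v‖² + ‖L₁ v‖² ≤ 2‖v‖²`, then `χ_δ(τ) ≤ χ_δ(σ)`: for a `δ`-approximation `Θ` of `σ` of rank
`χ_δ(σ)`, one of `‖τ - L_b Θ‖² = ‖L_b(σ - Θ)‖²` is at most `δ²`, and `L_b Θ` is a combination of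
`χ_δ(σ)` stabilizer states. (In print: `σ` the state before measuring the last qubit, `L_b` =
"project the last qubit on `|b⟩` and rescale by `√2`" followed by a Clifford, `p_0 = p_1`.)
[Mehraban–Tahmasbi 2024, Lemma 3.8 and its proof] [folklore] -/
theorem approxRank_le_of_balanced_reconstructions (δ : ℝ) (σ : QReg n → ℂ) (τ : QReg M → ℂ)
    (L₀ L₁ : (QReg n → ℂ) → (QReg M → ℂ))
    (hadd₀ : ∀ a b, L₀ (a + b) = L₀ a + L₀ b) (hsmul₀ : ∀ (c : ℂ) (a), L₀ (c • a) = c • L₀ a)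
    (hS₀ : ∀ φ ∈ stabilizerStates n, ∃ (d : ℂ) (φ' : QReg M → ℂ), φ' ∈ stabilizerStates M ∧ L₀ φ = d • φ')
    (hadd₁ : ∀ a b, L₁ (a + b) = L₁ a + L₁ b) (hsmul₁ : ∀ (c : ℂ) (a), L₁ (c • a) = c • L₁ a)
    (hS₁ : ∀ φ ∈ stabilizerStates n, ∃ (d : ℂ) (φ' : QReg M → ℂ), φ' ∈ stabilizerStates M ∧ L₁ φ = d • φ')
    (hτ₀ : τ = L₀ σ) (hτ₁ : τ = L₁ σ) (hnorm : ∀ v, normSq (L₀ v) + normSq (L₁ v) ≤ 2 * normSq v) :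
    approxStabilizerRank δ τ ≤ approxStabilizerRank δ σ := by
  obtain ⟨θ, hθ, hr⟩ := exists_approximant δ σ
  rw [← hr]
  have hsub₀ : L₀ (σ - θ) = L₀ σ - L₀ θ := by
    rw [sub_eq_add_neg, hadd₀, ← neg_one_smul ℂ θ, hsmul₀, neg_one_smul, ← sub_eq_add_neg]
  have hsub₁ : L₁ (σ - θ) = L₁ σ - L₁ θ := by
    rw [sub_eq_add_neg, hadd₁, ← neg_one_smul ℂ θ, hsmul₁, neg_one_smul, ← sub_eq_add_neg]
  have hsum := hnorm (σ - θ)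
  by_cases hcase : normSq (L₀ (σ - θ)) ≤ δ ^ 2
  · refine (approxStabilizerRank_le_of_witness δ τ (L₀ θ) ?_).trans (stabilizerRank_map_le L₀ hadd₀ hsmul₀ hS₀ θ)
    rwa [hτ₀, ← hsub₀]
  · have h₀ : 0 ≤ normSq (L₀ (σ - θ)) := Finset.sum_nonneg fun _ _ => by positivity
    refine (approxStabilizerRank_le_of_witness δ τ (L₁ θ) ?_).trans (stabilizerRank_map_le L₁ hadd₁ hsmul₁ hS₁ θ)
    rw [hτ₁, ← hsub₁]
    push Not at hcase
    linarith

/-- **The gadget step** (Lemma 3.8 applied to the `T` gadget): `χ_δ(T_q Φ) ≤ χ_δ(Φ ⊗ |T⟩)`.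
With `Ψ = CNOT_{q→a}(Φ ⊗ |T⟩_a)`, the two exact reconstructions `T_q Φ = √2·(1⊗⟨0|)Ψ`
(`projZ_cnot_mulVec_tensorVec_magicT`) and `T_q Φ = √2 ω⁻¹ S_q (1⊗⟨1|)Ψ`
(`sGate_mulVec_projZ_xWord_cnot_tensorVec_magicT`) form a balanced pair: by Pythagoras along the
magic wire and unitarity of `CNOT` and `S`, `‖√2 (1⊗⟨0|)CNOT v‖² + ‖√2 ω⁻¹ S_q(1⊗⟨1|)CNOT v‖² = 2‖v‖²`
(the uniformity of Lemma 3.7), and both maps send stabilizer states to scaled stabilizer states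
(Clifford gates, then the tree's removal lemma `exists_smul_stabilizer_projZ`).
[Mehraban–Tahmasbi 2024, Lemmas 3.7, 3.8 and proof of Lemma 3.6] [folklore] -/
theorem approxRank_tGate_mulVec_le (q : Fin M) (δ : ℝ) (Φ : QReg M → ℂ) :
    approxStabilizerRank δ (placeGate (wireEmb q) tGate *ᵥ Φ) ≤
      approxStabilizerRank δ (tensorVec Φ magicT) := by
  have hne := castAdd_one_ne_natAdd q
  have hCXmem : placeGate (pairEmb (Fin.castAdd 1 q) (Fin.natAdd M 0) hne) cnot ∈ cliffordCircuits (M + 1) :=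
    placeGate_cnot_mem _ _ hne
  have hXmem : (⟨xWord (Fin.natAdd M (0 : Fin 1))⟩ : QCircuit cliffordT (M + 1)).toMatrix 0 ∈
      cliffordCircuits (M + 1) := xWord_toMatrix_mem_cliffordCircuits 0 _
  have hSmem : placeGate (wireEmb q) sGate ∈ cliffordCircuits M := placeGate_sGate_mem q
  -- generalize the three Clifford matrices, keeping exactly the facts used below
  generalize hCX : placeGate (pairEmb (Fin.castAdd 1 q) (Fin.natAdd M 0) hne) cnot = CX at hCXmem
  generalize hX : (⟨xWord (Fin.natAdd M (0 : Fin 1))⟩ : QCircuit cliffordT (M + 1)).toMatrix 0 = X at hXmem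
  have hsplit : ∀ V : QReg (M + 1) → ℂ, normSq V = normSq (projZ 1 V) + normSq (projZ 1 (X *ᵥ V)) := by
    intro V; rw [← hX]; exact normSq_eq_projZ_add_projZ_xWord V
  have hgad₀ : placeGate (wireEmb q) tGate *ᵥ Φ = invSqrt2⁻¹ • projZ 1 (CX *ᵥ tensorVec Φ magicT) := by
    rw [← hCX, projZ_cnot_mulVec_tensorVec_magicT, smul_smul, inv_mul_cancel₀ invSqrt2_ne_zero, one_smul]
  have hgad₁ : placeGate (wireEmb q) tGate *ᵥ Φ =
      (invSqrt2 * omega)⁻¹ • (placeGate (wireEmb q) sGate *ᵥ projZ 1 (X *ᵥ (CX *ᵥ tensorVec Φ magicT))) := by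
    rw [← hCX, ← hX, sGate_mulVec_projZ_xWord_cnot_tensorVec_magicT, smul_smul,
      inv_mul_cancel₀ (mul_ne_zero invSqrt2_ne_zero (Complex.exp_ne_zero _)), one_smul]
  refine approxRank_le_of_balanced_reconstructions δ (tensorVec Φ magicT) _
    (fun v => invSqrt2⁻¹ • projZ 1 (CX *ᵥ v))
    (fun v => (invSqrt2 * omega)⁻¹ • (placeGate (wireEmb q) sGate *ᵥ projZ 1 (X *ᵥ (CX *ᵥ v))))
    (fun a b => ?_) (fun c a => ?_) (fun φ hφ => ?_) (fun a b => ?_) (fun c a => ?_) (fun φ hφ => ?_)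
    hgad₀ hgad₁ (fun v => le_of_eq ?_)
  · show invSqrt2⁻¹ • projZ 1 (CX *ᵥ (a + b)) = invSqrt2⁻¹ • projZ 1 (CX *ᵥ a) + invSqrt2⁻¹ • projZ 1 (CX *ᵥ b)
    rw [Matrix.mulVec_add, projZ_add, smul_add]
  · show invSqrt2⁻¹ • projZ 1 (CX *ᵥ (c • a)) = c • invSqrt2⁻¹ • projZ 1 (CX *ᵥ a)
    rw [Matrix.mulVec_smul, projZ_smul, smul_comm]
  · obtain ⟨d, φ', hφ', hd⟩ := exists_smul_stabilizer_projZ 1 (mulVec_mem_stabilizerStates hCXmem hφ)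
    refine ⟨invSqrt2⁻¹ * d, φ', hφ', ?_⟩
    show invSqrt2⁻¹ • projZ 1 (CX *ᵥ φ) = _
    rw [hd, smul_smul]
  · show (invSqrt2 * omega)⁻¹ • (placeGate (wireEmb q) sGate *ᵥ projZ 1 (X *ᵥ (CX *ᵥ (a + b)))) =
        (invSqrt2 * omega)⁻¹ • (placeGate (wireEmb q) sGate *ᵥ projZ 1 (X *ᵥ (CX *ᵥ a))) +
          (invSqrt2 * omega)⁻¹ • (placeGate (wireEmb q) sGate *ᵥ projZ 1 (X *ᵥ (CX *ᵥ b)))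
    rw [Matrix.mulVec_add CX a b, Matrix.mulVec_add X, projZ_add, Matrix.mulVec_add, smul_add]
  · show (invSqrt2 * omega)⁻¹ • (placeGate (wireEmb q) sGate *ᵥ projZ 1 (X *ᵥ (CX *ᵥ (c • a)))) =
        c • (invSqrt2 * omega)⁻¹ • (placeGate (wireEmb q) sGate *ᵥ projZ 1 (X *ᵥ (CX *ᵥ a)))
    rw [Matrix.mulVec_smul CX c a, Matrix.mulVec_smul X, projZ_smul, Matrix.mulVec_smul, smul_comm]
  · obtain ⟨d, φ', hφ', hd⟩ := exists_smul_stabilizer_projZ 1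
      (mulVec_mem_stabilizerStates hXmem (mulVec_mem_stabilizerStates hCXmem hφ))
    refine ⟨(invSqrt2 * omega)⁻¹ * d, placeGate (wireEmb q) sGate *ᵥ φ',
      mulVec_mem_stabilizerStates hSmem hφ', ?_⟩
    show (invSqrt2 * omega)⁻¹ • (placeGate (wireEmb q) sGate *ᵥ projZ 1 (X *ᵥ (CX *ᵥ φ))) = _
    rw [hd, Matrix.mulVec_smul, smul_smul]
  · show normSq (invSqrt2⁻¹ • projZ 1 (CX *ᵥ v)) +
        normSq ((invSqrt2 * omega)⁻¹ • (placeGate (wireEmb q) sGate *ᵥ projZ 1 (X *ᵥ (CX *ᵥ v)))) =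
          2 * normSq v
    rw [normSq_const_smul, normSq_const_smul, norm_invSqrt2_inv_sq, norm_invSqrt2_mul_omega_inv_sq,
      normSq_mulVec_of_mem_cliffordCircuits hSmem, ← mul_add, ← hsplit,
      normSq_mulVec_of_mem_cliffordCircuits hCXmem]

/-- **Clean ancillas in front do not lower the approximate rank**: `χ_δ(|0^N⟩ ⊗ φ) ≤ χ_δ(φ)`
("in the beginning, `χ_δ(|0ⁿ⟩ ⊗ |T^{⊗k}⟩) = χ_δ(|T^{⊗k}⟩)`"; tensoring a decomposition with the
stabilizer state `|0^N⟩` keeps the number of terms and the error). [Mehraban–Tahmasbi 2024,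
proof of Lemma 3.6] [folklore] -/
theorem approxRank_tensorVec_zeroState_left_le (δ : ℝ) (N : ℕ) {k : ℕ} (φ : QReg k → ℂ) :
    approxStabilizerRank δ (tensorVec (zeroState N) φ) ≤ approxStabilizerRank δ φ := by
  obtain ⟨θ, hθ, hr⟩ := exists_approximant δ φ
  rw [← hr]
  refine (approxStabilizerRank_le_of_witness δ _ (tensorVec (zeroState N) θ) ?_).trans ?_
  · have h1 : normSq (zeroState N) = 1 := normSq_basisState _
    rw [← tensorVec_sub_right, normSq_tensorVec, h1, one_mul]
    exact hθ
  · exact stabilizerRank_map_le (tensorVec (zeroState N)) (tensorVec_add_right _) (tensorVec_smul_right _)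
      (fun ψ hψ => ⟨1, _, tensorVec_mem_stabilizerStates (zeroState_mem_stabilizerStates N) hψ,
        (one_smul _ _).symm⟩) θ

end steps

/-! ### Removing clean ancillas: §3.4, step (a) -/

section ancilla

/-- `‖Φ‖² = ∑ₓ ∑_y |Φ(x, y)|²`: the squared norm of a vector on `n + m` wires as a double sum over
the two blocks of wires (reindexing along `Fin.appendEquiv`). [folklore] -/
theorem normSq_eq_sum_append {n m : ℕ} (Φ : QReg (n + m) → ℂ) :
    normSq Φ = ∑ x : QReg n, ∑ y : QReg m, ‖Φ (Fin.append x y)‖ ^ 2 := by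
  unfold Cryptography.normSq
  rw [← Fintype.sum_prod_type']
  exact (Fintype.sum_equiv (Fin.appendEquiv n m) _ _ fun p => rfl).symm

/-- **"The same approximation parameter"** — `‖ψ - (1 ⊗ ⟨0^m|)Φ‖² ≤ ‖ψ ⊗ |0^m⟩ - Φ‖²`: the
restriction `projZ m` to the block `y = 0^m` keeps only the coordinates `(x, 0^m)` of
`ψ ⊗ |0^m⟩ - Φ`, and on those coordinates `(ψ ⊗ |0^m⟩)(x, 0^m) = ψ(x)`.
[Mehraban–Tahmasbi 2024, §3.4 (a)] [folklore] -/
theorem normSq_sub_projZ_le {n m : ℕ} (ψ : QReg n → ℂ) (Φ : QReg (n + m) → ℂ) :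
    normSq (ψ - projZ m Φ) ≤ normSq (tensorVec ψ (zeroState m) - Φ) := by
  rw [normSq_eq_sum_append (tensorVec ψ (zeroState m) - Φ)]
  unfold Cryptography.normSq
  refine Finset.sum_le_sum fun x _ => ?_
  have key : ‖(ψ - projZ m Φ) x‖ ^ 2 =
      ‖(tensorVec ψ (zeroState m) - Φ) (Fin.append x fun _ => false)‖ ^ 2 := by
    rw [Pi.sub_apply, Pi.sub_apply, tensorVec_append, projZ_apply, zeroState, basisState_apply,
      if_pos rfl, mul_one]
  rw [key]
  exact Finset.single_le_sum
    (f := fun y : QReg m => ‖(tensorVec ψ (zeroState m) - Φ) (Fin.append x y)‖ ^ 2)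
    (fun y _ => sq_nonneg _) (Finset.mem_univ _)

/-- **"The same number of terms"** — `χ((1 ⊗ ⟨0^m|)Φ) ≤ χ(Φ)`: "`I ⊗ |0^λ⟩⟨0^λ|` maps stabilizer
states to scalar multiples of stabilizer states or `0`" (the tree's Gottesman–Knill postselection
rule `exists_smul_stabilizer_projZ`), so restricting a `χ(Φ)`-term stabilizer decomposition term by
term (`stabilizerRank_map_le`) gives one of `(1 ⊗ ⟨0^m|)Φ` with at most `χ(Φ)` terms.
[Mehraban–Tahmasbi 2024, §3.4 (a)] [folklore] -/
theorem stabilizerRank_projZ_le {n : ℕ} (m : ℕ) (Φ : QReg (n + m) → ℂ) :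
    stabilizerRank (projZ m Φ) ≤ stabilizerRank Φ :=
  stabilizerRank_map_le (projZ m) (projZ_add m) (projZ_smul m)
    (fun _ hφ => exists_smul_stabilizer_projZ m hφ) Φ

/-- **§3.4, step (a): removing clean ancillas does not lower the approximate rank**,
`χ_δ(ψ) ≤ χ_δ(ψ ⊗ |0^m⟩)`: an optimal `δ`-approximant `Θ` of `ψ ⊗ |0^m⟩` (`exists_approximant`)
restricts to the `δ`-approximant `(1 ⊗ ⟨0^m|)Θ` of `ψ` (`normSq_sub_projZ_le`) of rank at most
`χ(Θ) = χ_δ(ψ ⊗ |0^m⟩)` (`stabilizerRank_projZ_le`). [Mehraban–Tahmasbi 2024, §3.4 (a)] [folklore] -/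
theorem approxRank_le_approxRank_tensorVec_zeroState {n : ℕ} (δ : ℝ) (m : ℕ) (ψ : QReg n → ℂ) :
    approxStabilizerRank δ ψ ≤ approxStabilizerRank δ (tensorVec ψ (zeroState m)) := by
  obtain ⟨θ, hθ, hr⟩ := exists_approximant δ (tensorVec ψ (zeroState m))
  rw [← hr]
  exact (approxStabilizerRank_le_of_witness δ ψ (projZ m θ) ((normSq_sub_projZ_le ψ θ).trans hθ)).trans
    (stabilizerRank_projZ_le m θ)

end ancilla

/-! ### Gate-by-gate induction -/

section induction

variable {N : ℕ}

/-- The matrix of a placed `T` gate is the placement of `tGate` on its wire. [folklore] -/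
theorem toMatrix_gate_T (A : Language Bool) (e : Fin (cliffordT.arity CliffordTOp.T) ↪ Fin N) :
    (QGate.gate CliffordTOp.T e : QGate cliffordT N).toMatrix A = placeGate (wireEmb (embT e 0)) tGate := by
  rw [QGate.toMatrix_gate]
  exact congrArg (fun f : Fin 1 ↪ Fin N => placeGate f tGate) (emb_one_eq_wireEmb (embT e))

/-- **Gate-by-gate form of Lemma 3.6**: for an oracle-free Clifford+`T` gate list with `t`
`T`-gates and every input vector `ψ`, `χ_δ(U ψ) ≤ χ_δ(ψ ⊗ |T⟩^{⊗t})` (Clifford gates by Clifford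
invariance on the first tensor factor, `T` gates by the gadget step with a fresh magic wire).
[Mehraban–Tahmasbi 2024, proof of Lemma 3.6] [folklore] -/
theorem approxRank_toMatrix_mulVec_le (A : Language Bool) (δ : ℝ) :
    ∀ (L : List (QGate cliffordT N)), (∀ g ∈ L, g.IsOracleFree) → ∀ t : ℕ,
      (⟨L⟩ : QCircuit cliffordT N).tCount = t → ∀ ψ : QReg N → ℂ,
        approxStabilizerRank δ ((⟨L⟩ : QCircuit cliffordT N).toMatrix A *ᵥ ψ) ≤
          approxStabilizerRank δ (tensorVec ψ (tensorPow magicT t))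
  | [], _, t, ht, ψ => by
    rw [QCircuit.tCount_nil] at ht
    subst ht
    have h := projZ_zero_tensorVec_tensorPow_zero ψ
    rw [projZ_zero] at h
    rw [QCircuit.toMatrix_nil, Matrix.one_mulVec, h]
  | QGate.oracle k e :: L, hof, t, _, ψ => absurd (hof _ List.mem_cons_self) id
  | QGate.gate g e :: L, hof, t, ht, ψ => by
    have hofL : ∀ g' ∈ L, QGate.IsOracleFree g' := fun g' hg' => hof g' (List.mem_cons_of_mem _ hg')
    rw [QCircuit.tCount_cons] at ht
    rw [QCircuit.toMatrix_cons, ← Matrix.mulVec_mulVec]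
    cases g with
    | T =>
      rw [QGate.isT_gate_T, if_pos rfl] at ht
      subst ht
      refine (approxRank_toMatrix_mulVec_le A δ L hofL _ rfl _).trans ?_
      rw [toMatrix_gate_T, ← placeGate_castAddEmb_mulVec_tensorVec, placeGate_placeGate,
        wireEmb_trans_castAddEmb]
      refine (approxRank_tGate_mulVec_le _ δ _).trans (le_of_eq ?_)
      rw [tensorVec_tensorVec_one]
      rfl
    | H =>
      rw [QGate.isT_gate_H] at ht
      simp only [Bool.false_eq_true, if_false, add_zero] at ht
      refine (approxRank_toMatrix_mulVec_le A δ L hofL t ht _).trans ?_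
      rw [← placeGate_castAddEmb_mulVec_tensorVec]
      exact approxRank_mulVec_le_of_mem_cliffordCircuits (placeGate_mem_cliffordCircuits _
        (toMatrix_gate_mem_cliffordCircuits A CliffordTOp.H e (by decide))) δ _
    | S =>
      rw [QGate.isT_gate_S] at ht
      simp only [Bool.false_eq_true, if_false, add_zero] at ht
      refine (approxRank_toMatrix_mulVec_le A δ L hofL t ht _).trans ?_
      rw [← placeGate_castAddEmb_mulVec_tensorVec]
      exact approxRank_mulVec_le_of_mem_cliffordCircuits (placeGate_mem_cliffordCircuits _
        (toMatrix_gate_mem_cliffordCircuits A CliffordTOp.S e (by decide))) δ _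
    | CNOT =>
      rw [QGate.isT_gate_CNOT] at ht
      simp only [Bool.false_eq_true, if_false, add_zero] at ht
      refine (approxRank_toMatrix_mulVec_le A δ L hofL t ht _).trans ?_
      rw [← placeGate_castAddEmb_mulVec_tensorVec]
      exact approxRank_mulVec_le_of_mem_cliffordCircuits (placeGate_mem_cliffordCircuits _
        (toMatrix_gate_mem_cliffordCircuits A CliffordTOp.CNOT e (by decide))) δ _

end induction

end ApproxRankTransfer

open ApproxRankTransfer

/-! ### The discharge -/

/-- **Discharge of `MehrabanTahmasbi2024_approxRank_output_le`** — Mehraban–Tahmasbi 2024,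
Lemma 3.6: for a circuit `V` of Clifford gates and `k` `T` gates, `χ_δ(V|0⟩) ≤ χ_δ(|T⟩^{⊗k})`
(here: every oracle-free `U : QCircuit cliffordT N`, every oracle `A` — irrelevant — and every
`δ`). Proof as printed (§3.3): each `T` gate is replaced by the Gottesman–Chuang state-injection
gadget on a fresh magic wire; its two measurement outcomes have equal weight (Lemma 3.7, here the
common factor `√2` of the two exact reconstructions `T_q Φ = √2 (1⊗⟨0|)Ψ = √2 ω⁻¹ S_q (1⊗⟨1|)Ψ`,
`Ψ = CNOT(Φ ⊗ |T⟩)`), so for at least one outcome the approximate rank does not increase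
(Lemma 3.8, `approxRank_tGate_mulVec_le`); Clifford gates leave `χ_δ` invariant
(`approxRank_mulVec_le_of_mem_cliffordCircuits`); and `χ_δ(|0^N⟩ ⊗ |T⟩^{⊗k}) ≤ χ_δ(|T⟩^{⊗k})`
(`approxRank_tensorVec_zeroState_left_le`). [cite: MehrabanTahmasbi2024, Lemma 3.6 (with Lemmas 3.7, 3.8; arXiv:2305.10277 pp. 13–14)] -/
theorem MehrabanTahmasbi2024_approxRank_output_le_holds : MehrabanTahmasbi2024_approxRank_output_le := by
  intro N U hU A δ
  exact (approxRank_toMatrix_mulVec_le A δ U.gates hU U.tCount rfl (zeroState N)).trans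
    (approxRank_tensorVec_zeroState_left_le δ N _)

/-- **Discharge of `MehrabanTahmasbi2024_approxRank_le_tensor_zeroState`** — Mehraban–Tahmasbi 2024,
§3.4 step (a): removing clean ancillas does not lower the approximate stabilizer rank,
`χ_δ(ψ) ≤ χ_δ(ψ ⊗ |0^m⟩)` for every `n`-qubit vector `ψ`, every `m` and every real `δ`. Proof as
printed: "`I ⊗ |0^λ⟩⟨0^λ|` maps stabilizer states to scalar multiples of stabilizer states or `0`, and
therefore, any approximate decomposition of `φ ⊗ |0^λ⟩` into stabilizer states yields a decomposition
of `φ` with the same number of terms and approximation parameter" — here: the infimum defining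
`χ_δ(ψ ⊗ |0^m⟩)` is attained at some `Θ` (`exists_approximant`); its restriction `(1 ⊗ ⟨0^m|)Θ`
approximates `ψ` within the same `δ` (`normSq_sub_projZ_le`) and has `χ ≤ χ(Θ)`
(`stabilizerRank_projZ_le`, via the tree's Gottesman–Knill postselection rule
`exists_smul_stabilizer_projZ`), whence `χ_δ(ψ) ≤ χ((1 ⊗ ⟨0^m|)Θ) ≤ χ(Θ) = χ_δ(ψ ⊗ |0^m⟩)`
(`approxRank_le_approxRank_tensorVec_zeroState`). No hypothesis on `δ` is needed (the definition only
uses `δ²`), as in the vendored statement.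
[cite: MehrabanTahmasbi2024, §3.4 step (a) (arXiv:2305.10277 p. 14, the display concluding the proof of Thm. 3.1 and the sentence after it)] -/
theorem MehrabanTahmasbi2024_approxRank_le_tensor_zeroState_holds :
    MehrabanTahmasbi2024_approxRank_le_tensor_zeroState := by
  intro n m ψ δ
  exact approxRank_le_approxRank_tensorVec_zeroState δ m ψ

end Literature.Computability.QuantumComplexity
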